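import Summits.QuantumFields.YangMills.Theorems.BalabanLadderNTReflectionCauchySchwarzPos
import HarnessLib

/-!
# Crux `NT` (stmt-QuantumFields-19353): time translations of torus observables in mirror (Hankel) form

Helper file (`--supports stmt-QuantumFields-19353`) of the fleet lead prover of crux `NT` (unit `ym-spine-19353-p1`,
g10), hypothesis-free; first of the pair `…NTMirrorHankelShift` / `…NTMirrorHankel`.  Clause (i) of `LowerBounds` /
clause 4 of the registered stub `RefPkgT` (v4T) and the seam's (MF) currency are floors on the MIRROR FORM
`Cov_T(F∘ϑ, F)` of a positive-time observable `F` against its site-time-reflection `ϑ` on the odd tori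
`(ℤ/(2S+1)ℤ)^d`.  To read that currency as a function of the distance to the mirror one needs the time translates
`F_n` of `F` and the two elementary facts of this file (every dimension `d`, every group `G`, every side `L`):

* `slab lo hi` — the links with both endpoints at times in `[lo, hi]`; `timeShift n F` — `F` read `n` lattice units
  LATER (`U ↦ F (τ₋ₙ U)`, `τ_v = torusConfigShift v`); `dependsOn_timeShift` (the translate of a `[0, T]`-slab
  observable is a `[n, T+n]`-slab observable), `timeShift_timeShift`, `timeShift_zero`;
* `negReflect_torusConfigShift_time` — **`ϑ` conjugates a time translation to its inverse** (`τ_v ϑ = ϑ τ₋ᵥ` for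
  `v ∥ e₀`); `timeReflect_eq_shift_negReflect` — **the link reflection `Θ (t ↦ 1 − t)` is `ϑ (t ↦ −t)` followed by the
  unit translation**; hence `timeShift_negReflect`, `timeShift_succ_timeReflect` (`F_{s+1}∘Θ = F_s∘ϑ`);
* `integral_timeShift` (a translate has the law of the original) and **`integral_negReflect_timeShift_mul_timeShift`
  — translation invariance in Hankel form: `∫ (F_s∘ϑ) · H_t dμ = ∫ (F∘ϑ) · H_{s+t} dμ`** for Wilson's measure at any
  `β`: the mirror pairing of two translates depends only on the SUM of the translations.

The sequel `…NTMirrorHankel` combines these with the two reflection positivities of the odd torus.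
Refs: K. Osterwalder, E. Seiler, Ann. Phys. 110 (1978) 440, §2 (translations and reflections of the periodic lattice);
tree `WilsonNegRP.negReflect_torusConfigShift` (the half-period conjugation `ϑ τ_S = τ_S Θ`, of which
`timeReflect_eq_shift_negReflect` is the unit-step sibling).
-/

set_option autoImplicit false

noncomputable section

open MeasureTheory Finset
open Literature.MathematicalPhysics.QuantumFieldTheory
open Literature.MathematicalPhysics.QuantumFieldTheory.WilsonRP
open Literature.MathematicalPhysics.QuantumFieldTheory.WilsonOddRP
open Literature.MathematicalPhysics.QuantumFieldTheory.WilsonSiteRP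
open Literature.MathematicalPhysics.QuantumFieldTheory.WilsonNegRP
open Literature.MathematicalPhysics.QuantumFieldTheory.FariaDaVeigaOCarroll2022

namespace Summit.QuantumFields.YangMills.Cruxes.NT.MirrorHankel

variable {d L N : ℕ} [NeZero d] [NeZero L]
variable {G : Type*} [Group G] [TopologicalSpace G] [IsTopologicalGroup G] [CompactSpace G]
  [MeasurableSpace G] [BorelSpace G] (ρ : G →* Matrix (Fin N) (Fin N) ℂ)

/-! ## §1 Time translations of torus observables and the slabs they live on -/

/-- The closed time slab `lo ≤ t ≤ hi` of the torus of side `L`: links with both endpoints at times in `[lo, hi]`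
(times read through `ZMod.val ∈ [0, L)`).  `slab 0 S` is the closed non-negative half of the tree's
`sq_cov_negReflect_le_odd_pos`. -/
def slab (lo hi : ℕ) : Set (Edge d L) :=
  {e | lo ≤ (e.1 0).val ∧ (e.1 0).val ≤ hi ∧ ((e.1.shift e.2) 0).val ≤ hi}

/-- **Time translation of an observable by `n` lattice units into the future**: `timeShift n F U = F (τ₋ₙ U)` with
`τ_v = torusConfigShift v`, `(τ_v U)(x, i) = U (x − v, i)`; so `timeShift n F` reads the links `n` time units above
those `F` reads. -/
def timeShift {α : Type*} (n : ℕ) (F : GaugeConfig d L G → α) : GaugeConfig d L G → α :=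
  fun U => F (torusConfigShift (-(shiftVec (d := d) (L := L) n)) U)

omit [NeZero L] in
/-- Time coordinate after a translation by `n` without wrap-around. [folklore] -/
theorem val_add_shiftVec_zero {x : Site d L} {n : ℕ} (h : (x 0).val + n < L) :
    ((x + shiftVec (d := d) (L := L) n) 0).val = (x 0).val + n := by
  haveI : NeZero L := ⟨by omega⟩
  have hn : ((n : ℕ) : ZMod L).val = n := ZMod.val_cast_of_lt (by omega)
  simp only [shiftVec, Pi.add_apply, Pi.single_eq_same]
  rw [ZMod.val_add, hn, Nat.mod_eq_of_lt h]

omit [NeZero L] in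
/-- Translations commute with the unit shifts `x ↦ x + eᵢ`. [folklore] -/
theorem shift_add_shiftVec (x : Site d L) (n : ℕ) (i : Fin d) :
    (x + shiftVec (d := d) (L := L) n).shift i = x.shift i + shiftVec (d := d) (L := L) n := by
  simp only [Site.shift]
  exact add_right_comm _ _ _

omit [TopologicalSpace G] [IsTopologicalGroup G] [CompactSpace G] [BorelSpace G] [Group G] [NeZero L] in
/-- **The translate of a slab observable is a slab observable**: if `F` reads only links with both endpoints at times
`≤ T`, then `timeShift n F` reads only links with both endpoints at times in `[n, T + n]` (`T + n < L`: no
wrap-around). [folklore] -/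
theorem dependsOn_timeShift {α : Type*} {F : GaugeConfig d L G → α} {T : ℕ}
    (hF : DependsOn F (slab (d := d) (L := L) 0 T)) {n : ℕ} (hn : T + n < L) :
    DependsOn (timeShift n F) (slab (d := d) (L := L) n (T + n)) := by
  intro U V hUV
  unfold timeShift
  refine hF fun e he => ?_
  obtain ⟨-, he1, he2⟩ := he
  rw [torusConfigShift_apply, torusConfigShift_apply, sub_neg_eq_add]
  refine hUV _ ?_
  have h1 : ((e.1 + shiftVec (d := d) (L := L) n) 0).val = (e.1 0).val + n :=
    val_add_shiftVec_zero (by omega)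
  have h2 : (((e.1 + shiftVec (d := d) (L := L) n).shift e.2) 0).val = ((e.1.shift e.2) 0).val + n := by
    rw [shift_add_shiftVec]
    exact val_add_shiftVec_zero (by omega)
  refine ⟨?_, ?_, ?_⟩
  · rw [h1]; omega
  · rw [h1]; omega
  · rw [h2]; omega

omit [NeZero L] in
/-- `shiftVec` is additive. [folklore] -/
theorem shiftVec_add (s t : ℕ) :
    shiftVec (d := d) (L := L) (s + t) = shiftVec (d := d) (L := L) s + shiftVec (d := d) (L := L) t := by
  simp only [shiftVec, Nat.cast_add, Pi.single_add]

omit [TopologicalSpace G] [IsTopologicalGroup G] [CompactSpace G] [BorelSpace G] [Group G] [NeZero L] in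
/-- Iterated time translations add. [folklore] -/
theorem timeShift_timeShift {α : Type*} (s t : ℕ) (F : GaugeConfig d L G → α) :
    timeShift s (timeShift t F) = timeShift (s + t) F := by
  funext U
  -- translations compose additively (tree `PoincareToGap.covLC_shift_shift`, inlined to keep the imports light)
  have hcomp : ∀ (a b : Site d L) (V : GaugeConfig d L G),
      torusConfigShift a (torusConfigShift b V) = torusConfigShift (a + b) V :=
    fun a b V => funext fun e => by simp only [torusConfigShift_apply, sub_sub]
  simp only [timeShift, hcomp, shiftVec_add, neg_add, add_comm]

omit [TopologicalSpace G] [IsTopologicalGroup G] [CompactSpace G] [BorelSpace G] [Group G] [NeZero L] in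
/-- `timeShift 0` is the identity. [folklore] -/
theorem timeShift_zero {α : Type*} (F : GaugeConfig d L G → α) : timeShift 0 F = F := by
  funext U
  unfold timeShift
  congr 1
  funext e
  simp [torusConfigShift_apply, shiftVec]

omit [TopologicalSpace G] [IsTopologicalGroup G] [CompactSpace G] [BorelSpace G] [NeZero L] in
/-- **The site reflection conjugates a time translation to its inverse**: for a pure-time vector `v = c·e₀`,
`τ_v (ϑ U) = ϑ (τ₋ᵥ U)` (`ϑ = GaugeConfig.negReflect`). [folklore] -/
theorem negReflect_torusConfigShift_time (c : ZMod L) (U : GaugeConfig d L G) :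
    torusConfigShift (Pi.single (0 : Fin d) c) U.negReflect =
      (torusConfigShift (-(Pi.single (0 : Fin d) c)) U).negReflect := by
  -- the site identities `ϑ(x − v) = ϑx + v`, `ϑ((x − v) + e₀) = ϑ(x + e₀) + v`
  have hsite : ∀ x : Site d L, (x - Pi.single (0 : Fin d) c).negReflect =
      x.negReflect - -Pi.single (0 : Fin d) c := by
    intro x
    funext k
    by_cases hk : k = 0
    · subst hk
      simp [Site.negReflect]
      ring
    · simp [Site.negReflect, hk]
  have hsite' : ∀ x : Site d L, ((x - Pi.single (0 : Fin d) c).shift 0).negReflect =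
      (x.shift 0).negReflect - -Pi.single (0 : Fin d) c := by
    intro x
    have : (x - Pi.single (0 : Fin d) c).shift 0 = x.shift 0 - Pi.single (0 : Fin d) c := by
      simp only [Site.shift]; exact sub_add_eq_add_sub _ _ _
    rw [this, hsite]
  funext ⟨x, i⟩
  by_cases hi : i = 0
  · subst hi
    simp only [GaugeConfig.negReflect, ↓reduceIte, torusConfigShift_apply, hsite']
  · simp only [GaugeConfig.negReflect, if_neg hi, torusConfigShift_apply, hsite]

omit [TopologicalSpace G] [IsTopologicalGroup G] [CompactSpace G] [BorelSpace G] [NeZero L] in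
/-- **The link reflection is the site reflection followed by the unit time translation**:
`Θ U = τ_{e₀} (ϑ U)` (`Θ = GaugeConfig.timeReflect`, `t ↦ 1 − t`; `ϑ = GaugeConfig.negReflect`, `t ↦ −t`). [folklore] -/
theorem timeReflect_eq_shift_negReflect (U : GaugeConfig d L G) :
    U.timeReflect = torusConfigShift (shiftVec (d := d) (L := L) 1) U.negReflect := by
  have hsite : ∀ x : Site d L, (x - shiftVec (d := d) (L := L) 1).negReflect = x.timeReflect := by
    intro x
    funext k
    by_cases hk : k = 0
    · subst hk
      simp [Site.negReflect, Site.timeReflect, shiftVec]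
    · simp [Site.negReflect, Site.timeReflect, shiftVec, hk]
  have hsite' : ∀ x : Site d L, ((x - shiftVec (d := d) (L := L) 1).shift 0).negReflect =
      (x.shift 0).timeReflect := by
    intro x
    have : (x - shiftVec (d := d) (L := L) 1).shift 0 = x := by
      funext k
      by_cases hk : k = 0
      · subst hk; simp [Site.shift, shiftVec]
      · simp [Site.shift, shiftVec, hk]
    rw [this]
    funext k
    by_cases hk : k = 0
    · subst hk
      simp [Site.negReflect, Site.timeReflect, Site.shift]
    · simp [Site.negReflect, Site.timeReflect, Site.shift, hk]
  funext ⟨x, i⟩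
  by_cases hi : i = 0
  · subst hi
    simp only [GaugeConfig.timeReflect, GaugeConfig.negReflect, ↓reduceIte, torusConfigShift_apply, hsite']
  · simp only [GaugeConfig.timeReflect, GaugeConfig.negReflect, if_neg hi, torusConfigShift_apply, hsite]

omit [TopologicalSpace G] [IsTopologicalGroup G] [CompactSpace G] [BorelSpace G] [NeZero L] in
/-- The reflected translate: `(timeShift s F)(ϑU) = F (ϑ (τ_{s e₀} U))`. [folklore] -/
theorem timeShift_negReflect {α : Type*} (s : ℕ) (F : GaugeConfig d L G → α) (U : GaugeConfig d L G) :
    timeShift s F U.negReflect = F (torusConfigShift (shiftVec (d := d) (L := L) s) U).negReflect := by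
  unfold timeShift shiftVec
  have h := negReflect_torusConfigShift_time (d := d) (L := L) (G := G) (-((s : ℕ) : ZMod L)) U
  rw [Pi.single_neg, neg_neg] at h
  rw [h]

omit [TopologicalSpace G] [IsTopologicalGroup G] [CompactSpace G] [BorelSpace G] [NeZero L] in
/-- The link-reflected translate is the site-reflected previous translate:
`(timeShift (s+1) F)(ΘU) = (timeShift s F)(ϑU)`. [folklore] -/
theorem timeShift_succ_timeReflect {α : Type*} (s : ℕ) (F : GaugeConfig d L G → α) (U : GaugeConfig d L G) :
    timeShift (s + 1) F U.timeReflect = timeShift s F U.negReflect := by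
  rw [timeReflect_eq_shift_negReflect]
  unfold timeShift
  have hcomp : ∀ (a b : Site d L) (V : GaugeConfig d L G),
      torusConfigShift a (torusConfigShift b V) = torusConfigShift (a + b) V :=
    fun a b V => funext fun e => by simp only [torusConfigShift_apply, sub_sub]
  rw [hcomp, shiftVec_add, neg_add, neg_add_cancel_right]

/-! ## §2 Translation invariance in Hankel form -/

omit [NeZero d] in
/-- Every Wilson integral is invariant under translation of the integrand. [cite: OsterwalderSeiler1978, §2] -/
theorem integral_comp_torusConfigShift (β : ℝ) (v : Site d L) (Φ : GaugeConfig d L G → ℝ) :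
    ∫ U, Φ (torusConfigShift v U) ∂(wilsonMeasure ρ β) = ∫ U, Φ U ∂(wilsonMeasure ρ β) := by
  have h := wilsonExpectation_comp_torusConfigShift ρ β v Φ
  unfold wilsonExpectation at h
  exact h

/-- The translate has the law of the original: `∫ timeShift n F = ∫ F`. [cite: OsterwalderSeiler1978, §2] -/
theorem integral_timeShift (β : ℝ) (n : ℕ) (F : GaugeConfig d L G → ℝ) :
    ∫ U, timeShift n F U ∂(wilsonMeasure ρ β) = ∫ U, F U ∂(wilsonMeasure ρ β) :=
  integral_comp_torusConfigShift ρ β _ F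

/-- **Translation invariance in Hankel form.**  For any two observables `F, H` and shifts `s, t`:
`∫ (timeShift s F)(ϑU) · (timeShift t H)(U) dμ = ∫ F(ϑU) · (timeShift (s+t) H)(U) dμ` — the mirror pairing of two
translates depends only on the SUM of the translations (`ϑ` conjugates `τ_s` to `τ₋ₛ`, and `μ` is `τ`-invariant).
[cite: OsterwalderSeiler1978, §2] -/
theorem integral_negReflect_timeShift_mul_timeShift (β : ℝ) (s t : ℕ) (F H : GaugeConfig d L G → ℝ) :
    ∫ U, timeShift s F U.negReflect * timeShift t H U ∂(wilsonMeasure ρ β) =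
      ∫ U, F U.negReflect * timeShift (s + t) H U ∂(wilsonMeasure ρ β) := by
  rw [← integral_comp_torusConfigShift ρ β (shiftVec (d := d) (L := L) s)
    (fun U => F U.negReflect * timeShift (s + t) H U)]
  refine integral_congr_ae (ae_of_all _ fun U => ?_)
  simp only [timeShift_negReflect]
  congr 1
  have hcomp : ∀ (a b : Site d L) (V : GaugeConfig d L G),
      torusConfigShift a (torusConfigShift b V) = torusConfigShift (a + b) V :=
    fun a b V => funext fun e => by simp only [torusConfigShift_apply, sub_sub]
  simp only [timeShift, hcomp, shiftVec_add, neg_add_rev, neg_add_cancel_right]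

end Summit.QuantumFields.YangMills.Cruxes.NT.MirrorHankel

end
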